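import Summits.NavierStokesRegularity.NavierStokesRegularity.Theses.OddMorawetz
import Summits.NavierStokesRegularity.NavierStokesRegularity.Theses.SymmetryModuliCount
import Summits.NavierStokesRegularity.NavierStokesRegularity.Theorems.TypeICertificateLadderTargetTypeIZoom
import Literature.Analysis.FluidPDE.TypeIAncientMild
import HarnessLib

/-!
# Route OddMorawetz — `MorawetzKillsTypeI`: the Liouville exit

(crux item `stmt-NavierStokesRegularity-1377`, line `birth`; lands `--supports` the crux.)

The bridge `MorawetzKillsTypeI` has two honest exits (see `…Reduction.lean` for the first, the negative hunt at
weights 3 and 5). This file records the second: the KNSS LIOUVILLE CONJECTURE for the Oseen-gauge Type-I rate class,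
in the tree as the target `SymmetryModuliCount.TypeIAncientLiouville` of the sibling route, implies the crux outright —
by the landed Type-I zoom (`Theorems.stub_typeIZoom`, KNSS 2009 §6) a Type-I blow-up without classical extension
produces a nontrivial element of some rate class `IsTypeIAncientMild C`, which the Liouville statement kills; the
Morawetz certificate is not even used. (`TypeIAncientLiouville` is an OPEN conjecture; this is a conditional bridge
between two route declarations, not a discharge.)
-/

noncomputable section

-- the route's Theorems namespace repeats the summit name by design (Summit.<S>.<P>.Theorems, S = P)
set_option linter.dupNamespace false

namespace Summit.NavierStokesRegularity.NavierStokesRegularity.Theorems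

open MeasureTheory Filter Topology

/-- **The Liouville exit of the bridge**: `TypeIAncientLiouville → MorawetzKillsTypeI`. Given the KNSS Liouville
statement for the Oseen-gauge Type-I rate class (route `SymmetryModuliCount`, target decl, OPEN), every classical
Leray–Hopf solution from a rapidly decaying datum with a Type-I rate extends classically: otherwise the landed zoom
`Theorems.stub_typeIZoom` (with the dimensionless constant `C = max C₀ 1 / √ν`) yields a nontrivial
`ū ∈ IsTypeIAncientMild C`, i.e. (`isTypeIAncientMild_iff`) a nontrivial element of the class the Liouville statement
annihilates. The certificate hypotheses of the crux are idle here. -/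
theorem morawetzKillsTypeI_of_typeIAncientLiouville :
    Theses.SymmetryModuliCount.TypeIAncientLiouville → Theses.OddMorawetz.MorawetzKillsTypeI := by
  intro hL k m J Q _hk _hsm _hhom _hwt _hQ _hpos ν T hν hT u p hcl hLH hdec hI
  by_contra hext
  obtain ⟨C₀, hC₀⟩ := hI
  have hν' : 0 < Real.sqrt ν := Real.sqrt_pos.2 hν
  set C : ℝ := max C₀ 1 / Real.sqrt ν with hCdef
  have hC : 0 < C := div_pos (lt_of_lt_of_le one_pos (le_max_right _ _)) hν'
  have hrate : ∀ᶠ t in 𝓝[<] T, ∀ x, Real.sqrt (T - t) * ‖u t x‖ ≤ C * Real.sqrt ν := by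
    have hlt : ∀ᶠ t in 𝓝[<] T, t < T := eventually_nhdsWithin_of_forall fun t ht => ht
    filter_upwards [hC₀, hlt] with t ht htT x
    have hpos : 0 < Real.sqrt (T - t) := Real.sqrt_pos.2 (sub_pos.2 htT)
    have h1 : Real.sqrt (T - t) * ‖u t x‖ ≤ C₀ :=
      calc Real.sqrt (T - t) * ‖u t x‖ ≤ Real.sqrt (T - t) * (C₀ / Real.sqrt (T - t)) :=
            mul_le_mul_of_nonneg_left (ht x) hpos.le
        _ = C₀ := mul_div_cancel₀ C₀ hpos.ne'
    have h2 : C * Real.sqrt ν = max C₀ 1 := by rw [hCdef, div_mul_cancel₀ _ hν'.ne']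
    rw [h2]
    exact h1.trans (le_max_left _ _)
  obtain ⟨ū, hA, hnon⟩ := stub_typeIZoom C hC ν T hν hT u p hcl hLH hdec hrate hext
  exact hnon (hL C ū (Literature.Analysis.FluidPDE.isTypeIAncientMild_iff.1 hA))

end Summit.NavierStokesRegularity.NavierStokesRegularity.Theorems

end
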